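import Literature.MathematicalPhysics.QuantumFieldTheory.Balaban1983to89.B9SectDSup

/-!
# `Balaban1983to89.B9Thm33KnitJunctionWindows` — T. Bałaban, *Propagators for lattice gauge theories in a background field*, Commun. Math. Phys. **99** (1985)
# 389–434 [Balaban1985BackgroundPropagators], (3.106) p. 414 («R is an operator with small norm»), Thm 3.7 p. 410 («for M sufficiently large»), (3.19) p. 393 with
# [5] (52) («α₀ sufficiently small»): the THREE SMALLNESS WINDOWS of the bond-sector knit junction at a FIXED class-(52) parameter `α₀′ = a` — the constants
# `A_K, B_X, K_K, B₁, θ_F, κ_J` of t2s-1's `B9B8KnitBondWordDiffAtPars` are bounded by `a`-FREE starred constants once `a` is below three explicit thresholds,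
# and the junction's difference constant is `κ_J ≤ a·J⋆` — real-number bookkeeping only

statement-level skeleton of published theorems with citation tags; proofs where landed; nothing here is a claim about the Yang–Mills mass gap

WHY THIS FILE (cell `pub-ymgap`, node N06, seat `dag-n06-j` gen 36; file 8a of the chain «Thm 3.3's block at `parKnitY` on (3.35)»).  The member theorem
(`B9Thm33DeltaAAtKnitLetterOfRegYP335`) fixes the junction parameter `α₀′ := a₀K` once and for all; the three windows of the junction (file 9's `θ_EAc₁ < 1`, 23c's
`θ_FKC₄c₁c₁ < 1`, the transfer's `κ_JBΛc₁c₁ < 1`) then become inequalities between explicit real expressions in `a₀K` and member-free constants.  The named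
constants of `B9B8KnitBondWordDiffAtPars` (`θ_E = 32(d+1)²aκ`, `A_K = Ac_g(1 − θ_EAc_g)⁻¹`, `B_X = A₁(1 + c_g·θ_EAc_g(1 − θ_EAc_g)⁻¹)`, `θ_F`, `K_K`, `B₁ = max K K_K`,
`θ_X, θ_Y, θ_Q, θ_C`, `κ_J`) are monotone in the three `a`-dependent atoms `A_K, B_X, B₁`; below the first two windows these are bounded by `2Ac_g`, `A₁(1 + c_g)`,
`max K (2Kc₄)`, after which `κ_J ≤ a·J⋆` with `J⋆` free of `a`.

WHAT IS PROVED (sorry-free; 0 `def`; pure real-number lemmas).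
* `le_half_of_le_window` (`x ≥ 0`, `a ≤ 1∕(2x+1)` ⟹ `a·x ≤ ½`), `frac_le_one_of_le_half`, `lt_one_of_le_window` (`(1 − t)⁻¹ ≤ 2` is `B9SectDSup.inv_one_sub_le_two`).
* ★ `window_AK_BX` — `θ_EAc_g ≤ ½ ⟹ A_K ≤ 2Ac_g ∧ B_X ≤ A₁(1 + c_g)` (and `θ_EAc_g < 1`).
* ★ `thetaF_le` — `θ_F ≤ a·F⋆` (monotone in `A_K`).
* ★ `window_KK_B1` — `θ_FKC₄c₃c₄ ≤ ½ ⟹ K_K ≤ 2Kc₄ ∧ max K K_K ≤ max K (2Kc₄)`.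
* ★★ `kappaJ_le` — `κ_J ≤ a·J⋆` below the first two windows.
HONEST SCOPE.  Arithmetic; helper, count-neutral; N06 NOT discharged; nothing continuum ∕ OS ∕ mass gap ∕ Clay — the Yang–Mills mass gap is NOT proved here.
No `sorry`, no `axiom`, no `instance`, no `notation`, no `def`.  NEW file.
-/

namespace Literature.MathematicalPhysics.QuantumFieldTheory.Balaban1983to89.B9Thm33KnitJunctionWindows

open Literature.MathematicalPhysics.QuantumFieldTheory.Balaban1983to89.B9SectDSup (inv_one_sub_le_two)

/-- `0 ≤ x`, `0 ≤ a ≤ 1∕(2x+1)` ⟹ `a·x ≤ ½`. [cite: Balaban1985BackgroundPropagators, (3.106) p.414, bookkeeping] -/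
theorem le_half_of_le_window {a x : ℝ} (hx : 0 ≤ x) (ha : 0 ≤ a) (haw : a ≤ 1 / (2 * x + 1)) : a * x ≤ 1 / 2 := by
  have h1 : a * (2 * x + 1) ≤ 1 := by
    have := mul_le_mul_of_nonneg_right haw (by positivity : (0 : ℝ) ≤ 2 * x + 1)
    rwa [div_mul_cancel₀ _ (by positivity : (2 * x + 1 : ℝ) ≠ 0)] at this
  nlinarith

/-- `0 ≤ t ≤ ½` ⟹ `t(1 − t)⁻¹ ≤ 1`. [cite: Balaban1984PropagatorsII, (2.66) p.234, bookkeeping] -/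
theorem frac_le_one_of_le_half {t : ℝ} (h0 : 0 ≤ t) (h : t ≤ 1 / 2) : t * (1 - t)⁻¹ ≤ 1 := by
  have h2 := inv_one_sub_le_two h
  have hi : 0 ≤ (1 - t)⁻¹ := inv_nonneg.2 (by linarith)
  nlinarith

/-- `0 ≤ x`, `a ≤ 1∕(x+1)` ⟹ `a·x < 1`. [cite: Balaban1985BackgroundPropagators, (3.106) p.414, bookkeeping] -/
theorem lt_one_of_le_window {a x : ℝ} (hx : 0 ≤ x) (haw : a ≤ 1 / (x + 1)) : a * x < 1 := by
  have h1 : a * (x + 1) ≤ 1 := by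
    have := mul_le_mul_of_nonneg_right haw (by positivity : (0 : ℝ) ≤ x + 1)
    rwa [div_mul_cancel₀ _ (by positivity : (x + 1 : ℝ) ≠ 0)] at this
  nlinarith

/-- ★ **WINDOW 1** (file 9's `θ_EAc_g < 1` with room): with `θ_E = 32(d+1)²aκ` and `θ_EAc_g ≤ ½`: `A_K = Ac_g(1 − θ_EAc_g)⁻¹ ≤ 2Ac_g` and
`B_X = A₁(1 + c_g·θ_EAc_g(1 − θ_EAc_g)⁻¹) ≤ A₁(1 + c_g)`. [cite: Balaban1985BackgroundPropagators, Thm 3.7 (3.90) p.410, (3.106) p.414; Balaban1984PropagatorsII, (2.66) p.234] -/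
theorem window_AK_BX {W A A₁ cg : ℝ} (hW0 : 0 ≤ W) (hW : W ≤ 1 / 2) (hA : 0 ≤ A) (hA₁ : 0 ≤ A₁) (hcg : 0 ≤ cg) :
    W < 1 ∧ A * cg * (1 - W)⁻¹ ≤ 2 * A * cg ∧ A₁ * (1 + cg * (W * (1 - W)⁻¹)) ≤ A₁ * (1 + cg) := by
  refine ⟨by linarith, ?_, ?_⟩
  · have h2 := inv_one_sub_le_two hW
    have : A * cg * (1 - W)⁻¹ ≤ A * cg * 2 := mul_le_mul_of_nonneg_left h2 (mul_nonneg hA hcg)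
    linarith
  · have h1 := frac_le_one_of_le_half hW0 hW
    have : cg * (W * (1 - W)⁻¹) ≤ cg * 1 := mul_le_mul_of_nonneg_left h1 hcg
    nlinarith

/-- ★ **23b's constant is linear in `a` and monotone in `A_K`**: with `θ_E = 32(d+1)²aκ` and `0 ≤ A_K ≤ A_K⋆`,
`θ_F ≤ a·F⋆`, `F⋆ = (2(8(d+1)²)κ)κ(AACc₁) + κκ((A + A_K⋆)(A_K⋆(32(d+1)²κA)Cc₁)Cc₂) + κ(2(8(d+1)²)κ)(A_K⋆A_K⋆Cc₁)`.
[cite: Balaban1985BackgroundPropagators, (3.95) p.411, (3.90) p.410, bookkeeping] -/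
theorem thetaF_le {a κ A AK AKs C c₁ c₂ D : ℝ} (ha : 0 ≤ a) (hκ : 0 ≤ κ) (hA : 0 ≤ A) (hAK0 : 0 ≤ AK) (hAK : AK ≤ AKs) (hC : 0 ≤ C) (hc₁ : 0 ≤ c₁)
    (hc₂ : 0 ≤ c₂) (hD : 0 ≤ D) :
    (2 * (8 * D * a) * κ) * κ * (A * A * C * c₁) + κ * κ * ((A + AK) * (AK * ((32 * D * a * κ) * A) * C * c₁) * C * c₂)
        + κ * (2 * (8 * D * a) * κ) * (AK * AK * C * c₁)
      ≤ a * ((2 * (8 * D) * κ) * κ * (A * A * C * c₁) + κ * κ * ((A + AKs) * (AKs * ((32 * D * κ) * A) * C * c₁) * C * c₂)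
        + κ * (2 * (8 * D) * κ) * (AKs * AKs * C * c₁)) := by
  have hAKs : 0 ≤ AKs := hAK0.trans hAK
  have e : (2 * (8 * D * a) * κ) * κ * (A * A * C * c₁) + κ * κ * ((A + AK) * (AK * ((32 * D * a * κ) * A) * C * c₁) * C * c₂)
        + κ * (2 * (8 * D * a) * κ) * (AK * AK * C * c₁)
      = a * ((2 * (8 * D) * κ) * κ * (A * A * C * c₁) + κ * κ * ((A + AK) * (AK * ((32 * D * κ) * A) * C * c₁) * C * c₂)
        + κ * (2 * (8 * D) * κ) * (AK * AK * C * c₁)) := by ring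
  rw [e]
  gcongr

/-- ★ **WINDOW 2** (23c's `θ_FKC₄c₃c₄ < 1` with room): `θ_FKC₄c₃c₄ ≤ ½` ⟹ `K_K = Kc₄(1 − θ_FKC₄c₃c₄)⁻¹ ≤ 2Kc₄` and `max K K_K ≤ max K (2Kc₄)`.
[cite: Balaban1985BackgroundPropagators, Thm 3.2 (3.48) p.398, (3.106) p.414; Balaban1984PropagatorsII, (2.66) p.234] -/
theorem window_KK_B1 {W K c₄ : ℝ} (hW : W ≤ 1 / 2) (hK : 0 ≤ K) (hc₄ : 0 ≤ c₄) :
    W < 1 ∧ K * c₄ * (1 - W)⁻¹ ≤ 2 * K * c₄ ∧ max K (K * c₄ * (1 - W)⁻¹) ≤ max K (2 * K * c₄) := by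
  have h2 := inv_one_sub_le_two hW
  have hKK : K * c₄ * (1 - W)⁻¹ ≤ 2 * K * c₄ := by
    have : K * c₄ * (1 - W)⁻¹ ≤ K * c₄ * 2 := mul_le_mul_of_nonneg_left h2 (mul_nonneg hK hc₄)
    linarith
  exact ⟨by linarith, hKK, max_le_max le_rfl hKK⟩

/-- ★★ **THE JUNCTION's DIFFERENCE CONSTANT IS LINEAR IN `a`**: with `θ_E = 32(d+1)²aκ`, `θ_Q = 2(8(d+1)²a)κ`, `θ_X = B_Xθ_EAΛc_b`, `B_Y = (d+1)A₂`,
`θ_Y = A_Kθ_EB_YΛc_b`, `θ_C = B₁B₁θ_FΛ₄c₅²` and the atom bounds `B_X ≤ B_X⋆`, `B₁ ≤ B₁⋆`, `A_K ≤ A_K⋆`, `θ_F ≤ aF⋆` (all atoms `≥ 0`):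
`κ_J = Λ_B⁴c_B²(κ_Q²θ_XB₁B_Y + κ_Qθ_QB_XB₁B_Y + κ_Q²B_Xθ_CB_Y + θ_Qκ_QB_XB₁B_Y + κ_Q²B_XB₁θ_Y) ≤ a·J⋆` with
`J⋆ = Λ_B⁴c_B²(κ_Q²(B_X⋆(32(d+1)²κ)AΛc_b)B₁⋆B_Y + κ_Q(2(8(d+1)²)κ)B_X⋆B₁⋆B_Y + κ_Q²B_X⋆(B₁⋆B₁⋆F⋆Λ₄c₅²)B_Y + (2(8(d+1)²)κ)κ_QB_X⋆B₁⋆B_Y + κ_Q²B_X⋆B₁⋆(A_K⋆(32(d+1)²κ)B_YΛc_b))`.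
[cite: Balaban1985BackgroundPropagators, (3.49) p.399, (3.106) p.414; Balaban1984PropagatorsII, (2.50)–(2.52) p.232, bookkeeping] -/
theorem kappaJ_le {a κ κQ A BX BXs B₁ B1s BY AK AKs θF Fs Λ Λ₄ ΛB cb c₅ cB D : ℝ}
    (ha : 0 ≤ a) (hκ : 0 ≤ κ) (hκQ : 0 ≤ κQ) (hA : 0 ≤ A) (hBX0 : 0 ≤ BX) (hBX : BX ≤ BXs) (hB₁0 : 0 ≤ B₁) (hB₁ : B₁ ≤ B1s) (hBY : 0 ≤ BY)
    (hAK0 : 0 ≤ AK) (hAK : AK ≤ AKs) (hθF0 : 0 ≤ θF) (hθF : θF ≤ a * Fs) (hΛ : 0 ≤ Λ) (hΛ₄ : 0 ≤ Λ₄) (hcb : 0 ≤ cb) (hD : 0 ≤ D) :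
    ΛB ^ 4 * cB ^ 2 *
        (κQ * κQ * (BX * (32 * D * a * κ) * A * Λ * cb) * B₁ * BY + κQ * (2 * (8 * D * a) * κ) * BX * B₁ * BY
          + κQ * κQ * BX * (B₁ * B₁ * θF * Λ₄ * c₅ ^ 2) * BY + (2 * (8 * D * a) * κ) * κQ * BX * B₁ * BY
          + κQ * κQ * BX * B₁ * (AK * (32 * D * a * κ) * BY * Λ * cb))
      ≤ a * (ΛB ^ 4 * cB ^ 2 *
        (κQ * κQ * (BXs * (32 * D * κ) * A * Λ * cb) * B1s * BY + κQ * (2 * (8 * D) * κ) * BXs * B1s * BY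
          + κQ * κQ * BXs * (B1s * B1s * Fs * Λ₄ * c₅ ^ 2) * BY + (2 * (8 * D) * κ) * κQ * BXs * B1s * BY
          + κQ * κQ * BXs * B1s * (AKs * (32 * D * κ) * BY * Λ * cb))) := by
  have hBXs : 0 ≤ BXs := hBX0.trans hBX
  have hB1s : 0 ≤ B1s := hB₁0.trans hB₁
  have hAKs : 0 ≤ AKs := hAK0.trans hAK
  have hFs : 0 ≤ a * Fs := hθF0.trans hθF
  -- first replace the four atoms by their starred bounds (monotone polynomial with nonnegative coefficients)
  have step : ΛB ^ 4 * cB ^ 2 *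
        (κQ * κQ * (BX * (32 * D * a * κ) * A * Λ * cb) * B₁ * BY + κQ * (2 * (8 * D * a) * κ) * BX * B₁ * BY
          + κQ * κQ * BX * (B₁ * B₁ * θF * Λ₄ * c₅ ^ 2) * BY + (2 * (8 * D * a) * κ) * κQ * BX * B₁ * BY
          + κQ * κQ * BX * B₁ * (AK * (32 * D * a * κ) * BY * Λ * cb))
      ≤ ΛB ^ 4 * cB ^ 2 *
        (κQ * κQ * (BXs * (32 * D * a * κ) * A * Λ * cb) * B1s * BY + κQ * (2 * (8 * D * a) * κ) * BXs * B1s * BY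
          + κQ * κQ * BXs * (B1s * B1s * (a * Fs) * Λ₄ * c₅ ^ 2) * BY + (2 * (8 * D * a) * κ) * κQ * BXs * B1s * BY
          + κQ * κQ * BXs * B1s * (AKs * (32 * D * a * κ) * BY * Λ * cb)) := by
    gcongr
  refine step.trans (le_of_eq ?_)
  ring

end Literature.MathematicalPhysics.QuantumFieldTheory.Balaban1983to89.B9Thm33KnitJunctionWindows
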